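import Literature.Probability.Process.PoissonMultinomial
import Mathlib.Probability.Distributions.Poisson.Basic
import Mathlib.Probability.ProductMeasure
import HarnessLib

/-!
# A Poisson batch: `𝒫(m)` independent marks of law `ρ` (Kingman 1993 §2.5)

The building block of Kingman's construction of a Poisson process with a finite mean measure
`m ρ` (J. F. C. Kingman, *Poisson Processes* (1993), §2.5, proof of the Existence Theorem:
take `N` Poisson `𝒫(μ(S))` and, independently, `X₁, X₂, …` independent with distribution
`μ(·)/μ(S)`; then `{X₁, …, X_N}` is a Poisson process with mean measure `μ`), on the
canonical space `ℕ × (ℕ → E)` (the number `N` of marks used, and the whole sequence of marks):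

* `Literature.Probability.Process.batchCount s (N, x) = #{k < N | x k ∈ s}`, measurable in
  `(N, x)` for measurable `s`;
* `Literature.Probability.Process.category s x ∈ Option (Fin q)` — which of the pairwise
  disjoint sets `s₀, …, s_{q-1}` contains `x` (`none` if none does) — and the description of the
  count events `{∀ i, #{k | y k ∈ s i} = c i}` of finitely many marks `y : K → E` as finite
  disjoint unions of boxes (`Literature.Probability.Process.countEvent_eq_biUnion`);
* `Literature.Probability.Process.batchMeasure m ρ = 𝒫(m) ⊗ ρ^{⊗ℕ}`, and the mass of a count
  event under the finite product `ρ^{⊗K}`: the multinomial probability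
  `multinomialProb (ρ ∘ s) c |K|` of `PoissonMultinomial`
  (`Literature.Probability.Process.pi_countEvent_eq`).

The law of the count vector of a batch (a product of Poisson laws) is derived in the sequel
`PoissonBatchLaw`.
-/

noncomputable section

open MeasureTheory ProbabilityTheory Finset
open scoped ENNReal NNReal

namespace Literature.Probability.Process

section Counting

variable {E : Type*}

/-! ### Counting the marks of a batch -/

open Classical in
/-- **The number of points of the batch in `s`**: `#{k < N | x k ∈ s}`, the first `N` marks being
the points of the batch `(N, x)` (Kingman 1993 §2.5: the points are `X₁, …, X_N`).
[cite: Kingman1993, §2.5 Existence Theorem] -/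
def batchCount (s : Set E) (b : ℕ × (ℕ → E)) : ℕ :=
  ((range b.1).filter fun k ↦ b.2 k ∈ s).card

/-- `batchCount s (n, x)` as a sum of indicators over `k < n`. [folklore] -/
theorem batchCount_eq_sum_indicator (s : Set E) (n : ℕ) (x : ℕ → E) :
    batchCount s (n, x) = ∑ k ∈ range n, s.indicator (1 : E → ℕ) (x k) := by
  classical
  rw [batchCount, Finset.card_filter]
  refine Finset.sum_congr rfl fun k _ ↦ ?_
  simp only [Set.indicator_apply, Pi.one_apply]

/-- The batch count is at most the number of points `N`. [folklore] -/
theorem batchCount_le (s : Set E) (b : ℕ × (ℕ → E)) : batchCount s b ≤ b.1 := by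
  classical
  unfold batchCount
  exact (Finset.card_filter_le _ _).trans (Finset.card_range _).le

/-- The batch count of `(n, x)` in terms of the restriction of `x` to `range n`. [folklore] -/
theorem batchCount_eq_card_univ_filter (s : Set E) (n : ℕ) (x : ℕ → E) [DecidablePred (· ∈ s)] :
    batchCount s (n, x) = (univ.filter fun k : ↥(range n) ↦ x k ∈ s).card := by
  classical
  rw [batchCount, ← Finset.attach_eq_univ, Finset.filter_attach (fun k ↦ x k ∈ s) (range n),
    Finset.card_map, Finset.card_attach]
  exact congrArg Finset.card (Finset.filter_congr_decidable _ _ _)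

/-! ### Categories of points relative to disjoint sets -/

variable {q : ℕ}

open Classical in
/-- **The category of a point** relative to sets `s₀, …, s_{q-1}`: `some i` with `x ∈ s i` if
there is such an `i` (unique for pairwise disjoint sets), `none` if `x` lies in none of them.
[folklore] -/
def category (s : Fin q → Set E) (x : E) : Option (Fin q) :=
  if h : ∃ i, x ∈ s i then some h.choose else none

variable {s : Fin q → Set E}

/-- For pairwise disjoint sets, `category s x = some i ↔ x ∈ s i`. [folklore] -/
theorem category_eq_some_iff (hd : Pairwise (Function.onFun Disjoint s)) {x : E} {i : Fin q} :
    category s x = some i ↔ x ∈ s i := by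
  classical
  unfold category
  constructor
  · intro h
    split_ifs at h with h'
    rw [Option.some_inj] at h
    rw [← h]
    exact h'.choose_spec
  · intro hx
    have h' : ∃ i, x ∈ s i := ⟨i, hx⟩
    rw [dif_pos h', Option.some_inj]
    by_contra hne
    exact Set.disjoint_left.1 (hd hne) h'.choose_spec hx

/-- `category s x = none ↔ x` lies in no `s i`. [folklore] -/
theorem category_eq_none_iff {x : E} : category s x = none ↔ ∀ i, x ∉ s i := by
  classical
  unfold category
  split_ifs with h
  · simp only [false_iff, not_forall, not_not]
    exact h
  · simp only [true_iff]
    exact fun i hi ↦ h ⟨i, hi⟩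

/-- The preimage of `some i` under the category map is `s i`. [folklore] -/
theorem category_preimage_some (hd : Pairwise (Function.onFun Disjoint s)) (i : Fin q) :
    category s ⁻¹' {some i} = s i := by
  ext x
  exact category_eq_some_iff hd

/-- The preimage of `none` under the category map is the complement of `⋃ s i`. [folklore] -/
theorem category_preimage_none (s : Fin q → Set E) : category s ⁻¹' {none} = (⋃ i, s i)ᶜ := by
  ext x
  simp only [Set.mem_preimage, Set.mem_singleton_iff, Set.mem_compl_iff, Set.mem_iUnion, not_exists]
  exact category_eq_none_iff

/-- Counting the points of a finite family in `s i` is counting the fibre of `some i` of the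
category map. [folklore] -/
theorem card_filter_mem_eq_fiberCount (hd : Pairwise (Function.onFun Disjoint s)) {K : Type*} [Fintype K]
    (y : K → E) (i : Fin q) [DecidablePred (· ∈ s i)] :
    (univ.filter fun k ↦ y k ∈ s i).card = fiberCount (category s ∘ y) (some i) := by
  classical
  rw [fiberCount_apply]
  congr 1
  refine Finset.filter_congr fun k _ ↦ ?_
  rw [Function.comp_apply, category_eq_some_iff hd]

/-- **The count event in terms of fibre counts**: finitely many marks `y` have `c i` points in
each `s i` iff the fibre counts of `category s ∘ y` are `countVector c |K|` (the complementary
category then has `|K| − ∑ c` points). [folklore] -/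
theorem forall_card_filter_eq_iff (hd : Pairwise (Function.onFun Disjoint s)) {K : Type*} [Fintype K]
    [∀ i, DecidablePred (· ∈ s i)] (y : K → E) (c : Fin q → ℕ) :
    (∀ i, (univ.filter fun k ↦ y k ∈ s i).card = c i) ↔
      ∀ j, fiberCount (category s ∘ y) j = countVector c (Fintype.card K) j := by
  classical
  simp_rw [card_filter_mem_eq_fiberCount hd]
  constructor
  · intro h j
    cases j with
    | some i => exact h i
    | none =>
      have hsum := sum_fiberCount (category s ∘ y)
      rw [Fintype.sum_option] at hsum
      simp_rw [h] at hsum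
      rw [countVector_none]
      omega
  · intro h i
    exact h (some i)

/-! ### The count events as unions of boxes -/

/-- The box of mark vectors with prescribed categories `f`. [folklore] -/
def categoryBox (s : Fin q → Set E) {K : Type*} (f : K → Option (Fin q)) : Set (K → E) :=
  Set.univ.pi fun k ↦ category s ⁻¹' {f k}

/-- Membership in a category box. [folklore] -/
theorem mem_categoryBox_iff {K : Type*} {f : K → Option (Fin q)} {y : K → E} :
    y ∈ categoryBox s f ↔ category s ∘ y = f := by
  simp [categoryBox, funext_iff]

/-- Distinct category vectors give disjoint boxes. [folklore] -/
theorem disjoint_categoryBox {K : Type*} {f g : K → Option (Fin q)} (h : f ≠ g) :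
    Disjoint (categoryBox s f) (categoryBox s g) :=
  Set.disjoint_left.2 fun _ hf hg ↦ h ((mem_categoryBox_iff.1 hf).symm.trans (mem_categoryBox_iff.1 hg))

/-- **The count event of finitely many marks is a finite disjoint union of category boxes**,
over the category vectors with fibre counts `countVector c |K|`. [folklore] -/
theorem countEvent_eq_biUnion (hd : Pairwise (Function.onFun Disjoint s)) {K : Type*} [Fintype K]
    [DecidableEq K] [∀ i, DecidablePred (· ∈ s i)] (c : Fin q → ℕ) :
    {y : K → E | ∀ i, (univ.filter fun k ↦ y k ∈ s i).card = c i} =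
      ⋃ f ∈ (univ.filter fun f : K → Option (Fin q) ↦ ∀ j, fiberCount f j = countVector c (Fintype.card K) j),
        categoryBox s f := by
  ext y
  rw [Set.mem_setOf_eq, forall_card_filter_eq_iff hd, Set.mem_iUnion₂]
  simp only [Finset.mem_filter, Finset.mem_univ, true_and, mem_categoryBox_iff]
  constructor
  · intro h
    exact ⟨category s ∘ y, h, rfl⟩
  · rintro ⟨f, hf, rfl⟩
    exact hf

end Counting

/-! ### The batch measure and the mass of count events -/

section Measure

variable {E : Type*} [MeasurableSpace E]

/-- **The law of a Poisson batch** on `ℕ × (ℕ → E)`: a `𝒫(m)`-distributed number `N` and,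
independently, an i.i.d. sequence of marks of law `ρ` (Kingman 1993 §2.5, proof of the
Existence Theorem). [cite: Kingman1993, §2.5 Existence Theorem] -/
def batchMeasure (m : ℝ≥0) (ρ : Measure E) [IsProbabilityMeasure ρ] : Measure (ℕ × (ℕ → E)) :=
  (poissonMeasure m).prod (Measure.infinitePi fun _ : ℕ ↦ ρ)

/-- The law of a Poisson batch is a probability measure. [folklore] -/
instance isProbabilityMeasure_batchMeasure (m : ℝ≥0) (ρ : Measure E) [IsProbabilityMeasure ρ] :
    IsProbabilityMeasure (batchMeasure m ρ) := by
  unfold batchMeasure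
  infer_instance

/-- The batch counts are measurable for measurable `s`. [folklore] -/
@[fun_prop]
theorem measurable_batchCount {s : Set E} (hs : MeasurableSet s) : Measurable (batchCount s) := by
  refine measurable_from_prod_countable_right fun n ↦ ?_
  simp_rw [batchCount_eq_sum_indicator]
  exact Finset.measurable_sum _ fun k _ ↦ (measurable_one.indicator hs).comp (measurable_pi_apply k)

variable {q : ℕ} {s : Fin q → Set E}

/-- The fibres of the category map are measurable. [folklore] -/
theorem measurableSet_preimage_category (hm : ∀ i, MeasurableSet (s i))
    (hd : Pairwise (Function.onFun Disjoint s)) (j : Option (Fin q)) :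
    MeasurableSet (category s ⁻¹' {j}) := by
  cases j with
  | none =>
    rw [category_preimage_none]
    exact (MeasurableSet.iUnion hm).compl
  | some i =>
    rw [category_preimage_some hd]
    exact hm i

/-- Category boxes are measurable. [folklore] -/
theorem measurableSet_categoryBox (hm : ∀ i, MeasurableSet (s i)) (hd : Pairwise (Function.onFun Disjoint s))
    {K : Type*} [Countable K] (f : K → Option (Fin q)) : MeasurableSet (categoryBox s f) :=
  MeasurableSet.univ_pi fun k ↦ measurableSet_preimage_category hm hd (f k)

/-- The mass of a category box under `ρ^{⊗K}` is the product of the category probabilities. [folklore] -/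
theorem pi_categoryBox (ρ : Measure E) [IsProbabilityMeasure ρ] {K : Type*} [Fintype K]
    (f : K → Option (Fin q)) :
    Measure.pi (fun _ : K ↦ ρ) (categoryBox s f) = ∏ k, ρ (category s ⁻¹' {f k}) := by
  rw [categoryBox, Measure.pi_pi]

/-- The category probabilities are the weights `weightVector (ρ ∘ s)` of `PoissonMultinomial`:
`ρ (s i)` for `some i`, `1 − ∑ ρ (s i)` for `none`. [folklore] -/
theorem measure_preimage_category (ρ : Measure E) [IsProbabilityMeasure ρ] (hm : ∀ i, MeasurableSet (s i))
    (hd : Pairwise (Function.onFun Disjoint s)) (j : Option (Fin q)) :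
    ρ (category s ⁻¹' {j}) = ENNReal.ofReal (weightVector (fun i ↦ ρ.real (s i)) j) := by
  cases j with
  | some i => rw [category_preimage_some hd, weightVector_some, ofReal_measureReal]
  | none =>
    rw [category_preimage_none, weightVector_none, ← ofReal_measureReal, measureReal_compl
      (MeasurableSet.iUnion hm), probReal_univ, measureReal_iUnion_fintype hd hm]

/-- The weights `weightVector (ρ ∘ s)` are nonnegative. [folklore] -/
theorem weightVector_measureReal_nonneg (ρ : Measure E) [IsProbabilityMeasure ρ] (hm : ∀ i, MeasurableSet (s i))
    (hd : Pairwise (Function.onFun Disjoint s)) (j : Option (Fin q)) :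
    0 ≤ weightVector (fun i ↦ ρ.real (s i)) j := by
  cases j with
  | some i => exact measureReal_nonneg
  | none =>
    rw [weightVector_none, ← measureReal_iUnion_fintype hd hm, sub_nonneg, ← probReal_univ (μ := ρ)]
    exact measureReal_mono (Set.subset_univ _)

/-- **The mass of the count event under `ρ^{⊗K}` is the multinomial probability**
`multinomialProb (ρ ∘ s) c |K|` of `PoissonMultinomial` (Kingman 1993 §1.2: the category counts
of independent trials are multinomial). [cite: Kingman1993, §2.5 Existence Theorem] -/
theorem pi_countEvent_eq (ρ : Measure E) [IsProbabilityMeasure ρ] (hm : ∀ i, MeasurableSet (s i))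
    (hd : Pairwise (Function.onFun Disjoint s)) {K : Type*} [Fintype K] [DecidableEq K]
    [∀ i, DecidablePred (· ∈ s i)] (c : Fin q → ℕ) :
    Measure.pi (fun _ : K ↦ ρ) {y : K → E | ∀ i, (univ.filter fun k ↦ y k ∈ s i).card = c i} =
      ENNReal.ofReal (multinomialProb (fun i ↦ ρ.real (s i)) c (Fintype.card K)) := by
  classical
  rw [countEvent_eq_biUnion hd, measure_biUnion_finset]
  rotate_left
  · intro f _ g _ hfg
    exact disjoint_categoryBox hfg
  · intro f _
    exact measurableSet_categoryBox hm hd f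
  simp_rw [pi_categoryBox, measure_preimage_category ρ hm hd]
  have hw0 := weightVector_measureReal_nonneg ρ hm hd
  rw [multinomialProb, ← sum_prod_eq_multinomial (weightVector _) (countVector c (Fintype.card K)),
    ENNReal.ofReal_sum_of_nonneg fun f _ ↦ Finset.prod_nonneg fun k _ ↦ hw0 (f k)]
  exact Finset.sum_congr rfl fun f _ ↦ (ENNReal.ofReal_prod_of_nonneg fun k _ ↦ hw0 (f k)).symm

end Measure

end Literature.Probability.Process

end
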